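import Literature.NumberTheory.Automorphic.ReciprocityGLnProofs
import Literature.NumberTheory.GaloisRepresentations.AbsGaloisOuterConj
import Literature.NumberTheory.GaloisRepresentations.OrdinaryRegular
import Literature.NumberTheory.GaloisRepresentations.PstWeilDeligne
import HarnessLib

/-!
# `ℓ`-adic limits of ordinary, polarized, cuspidal-automorphic Galois traces

Topic `Literature/NumberTheory/Automorphic`; definition request
`defn-IsOrdinaryPolarizedAutomorphicLimit` of route `Summits/Langlands/Langlands/Theses/
SiegelEisensteinFern.lean` (rev 1), whose items `SiegelLimitExistence` (stmt-Langlands-2690),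
`SiegelLimitReciprocity` (-2691) and `SiegelLimitOfAutomorphic` (-2693) inline the notion defined
here (their common `∀ M, ∃ k d hd P r, …` clause) and can be restated through it in one line each.

## What this is

Fix a number field `K`, a continuous endomorphism `θ` of `Γ_K` (the *polarization involution*;
the route binds `θ : Γ_K →ₜ* Γ_K` through `res ∘ θ = Int(c) ∘ res` for a `c ∈ Γ_{K⁺}` outside
`res(Γ_K)`, `K` CM — which forces `θ = θ_c = absGaloisOuterConj K⁺ K c`, `eq_absGaloisOuterConj`
below), a prime `ℓ`, `ι : ℚ̄_ℓ ≃+* ℂ`, a total dimension `N`, a set `S` of finite places of `K`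
(a *level datum*) and `T : Γ_K → ℚ̄_ℓ`.  `IsOrdinaryPolarizedAutomorphicLimit ι θ N S T` says:
**for every `M : ℕ` there are finitely many cuspidal automorphic representations `Π_j` of
`GL_{d_j}(𝔸_K)`, `∑_j d_j = N`, each regular algebraic, and framed Galois representations
`r_j : Γ_K → GL_{d_j}(ℚ̄_ℓ)` such that**

* `r_j` is attached to `Π_j` in the sense of **lang.S27** (Harris–Lan–Taylor–Thorne Thm. A with
  Varma; `Literature.NumberTheory.Automorphic.exists_galoisRep_of_regularAlgebraic`): at every
  `v ∤ ℓ` and every Satake parameter `α` of `Π_{j,v}`, `r_j` is unramified at `v` with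
  arithmetic-Frobenius characteristic polynomial `arithFrobPolyOfSatake ι q_v d_j α` — the accepted
  `IsGaloisCompatibleAt Π_j ι r_j v` (`ReciprocityGLnProofs`) at all `v ∤ ℓ`;
* `r_j` is unramified at every `v ∈ S`;
* at every `v ∣ ℓ`, `r_j` is **ordinary with unramified-twisted cyclotomic diagonal and strictly
  decreasing exponents** (`FramedGaloisRep.IsCyclotomicOrdinaryAt`, below);
* the total trace `t = ∑_j tr r_j` is **polarized in trace form**: `t(θσ) = χ(σ) t(σ⁻¹)` for
  some continuous character `χ : Γ_K → GL_1(ℚ̄_ℓ)` (`IsTracePolarized`, below; for semisimple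
  `r = ⊕ r_j`: `r ∘ θ ≅ r^∨ ⊗ χ`);
* **`‖t(σ) - T(σ)‖ ≤ (ℓ⁻¹)^M` for all `σ ∈ Γ_K`** (norm of Mathlib's `PadicAlgCl ℓ`).

So `T` is a uniform `ℓ`-adic limit on `Γ_K` of traces of Galois representations attached to
(formal isobaric sums `⊞_j Π_j` of) cuspidal, regular algebraic, `ℓ`-ordinary automorphic
representations "of `U(n,n)`-type", of level `S`, each sum polarized.  The companion
`siegelEisensteinTrace θ ρ μ = tr ρ + tr μ · tr ((ρ ∘ θ)^∨)` is the trace of the Siegel–Eisenstein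
representation `R₀ = ρ ⊕ (ρ ∘ θ)^∨ ⊗ μ` at which the route evaluates the predicate.

## Contents

Namespace `Literature.NumberTheory.GaloisRepresentations` (dot-notation extensions of the
accepted `FramedRep` / `FramedGaloisRep`, declared with absolute names):
`FramedRep.IsCyclotomicOrdinaryTriangular ρ` (`ρ : Γ_F → GL_d(ℚ̄_ℓ)`, `F` a non-archimedean local
field: `ρ(σ)` upper triangular with diagonal `ψ_i(σ) ε_ℓ(σ)^{b_i}`, `ψ_i` unramified — accepted
`FramedRep.IsLocallyUnramified` —, `ε_ℓ` the accepted `GaloisRep.cyclotomicCharacter`,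
`b : Fin d → ℤ` strictly decreasing); `FramedRep.IsCyclotomicOrdinary ρ` (some change of frame
`g ρ g⁻¹`, accepted `FramedRep.conj`, is such); `FramedGaloisRep.IsCyclotomicOrdinaryAt v r :=
(r|_{Γ_{K_v}}).IsCyclotomicOrdinary` (accepted `toLocal`) — unfolded, VERBATIM the clause
"crystalline-ordinary with distinct Hodge–Tate weights at `v ∣ ℓ`" inlined five times in the
route; `isCyclotomicOrdinaryTriangular_iff` (the same via the accepted `IsUpperTriangular` /
`diagEntry` of `OrdinaryRegular`); frame invariance (`isCyclotomicOrdinary(_At)_conj_iff`, by the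
accepted `conj_conj`, `toLocal_conj`); `eq_absGaloisOuterConj` (the route's binder `θ` IS `θ_c`).
Namespace `Literature.NumberTheory.Automorphic`: `IsTracePolarized θ t` (API `.zero`,
`.const_mul`, `.add_of_eq`); `siegelEisensteinTrace θ ρ μ` (unfolding; `= tr ρ + tr μ · tr (ρ^c)^∨`
for `θ = θ_c`, accepted `FramedGaloisRep.outerConj`); `IsOrdinaryPolarizedAutomorphicLimit ι θ N S
T` with API: antitone in `S` (`.anti`), `.congr`, an exact datum is a limit (`.of_exact`),
**limits of limits are limits** (`.of_approx`), and `isOrdinaryPolarizedAutomorphicLimit_iff` —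
the unfolding to the primitive vocabulary in the binder order of the route, so that the
conclusion of `SiegelLimitExistence` is `IsOrdinaryPolarizedAutomorphicLimit ι θ (n + n)
{v | ρ.IsUnramifiedAt v ∧ μ.IsUnramifiedAt v ∧ ℓ ∉ v} (siegelEisensteinTrace θ ρ μ)` up to currying
the level clause (the three rev-1 items were restated this way and proved `↔` the originals by
`simp only [isOrdinaryPolarizedAutomorphicLimit_iff, …, Set.mem_setOf_eq, and_imp]` in the
definition session; that check imports `Summits` and is not shipped).

## Design notes

* GL-level, as requested: no unitary groups / eigenvarieties / Hida families are needed to STATE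
  the notion; a "cuspidal polarized ordinary automorphic representation of `U(n,n)`-type" is the
  finite family `(Π_j)` (formal isobaric sum; only the trace of `⊕ r_j` is used).  `K : Type` is
  forced by the accepted `CuspidalAutomorphicRepData`; the compactness facts `hd j` typing `Π_j`
  are part of the datum (true named fact `isCompact_glFiniteIntegralLevel`, as in lang.S28).
* Matching at ALL `v ∤ ℓ` where `Π_j` is unramified (lang.S27 shape, accepted
  `IsGaloisCompatibleAt`), not merely almost everywhere — what the route inlines.
* `χ` is a character of `Γ_K` and no sign is imposed ("polarized in trace form", as in the route)
  — weaker than an essentially conjugate self-dual PAIR `(r, μ)`, `μ : Γ_{K⁺} → ℚ̄_ℓ^×`, with its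
  pairing and sign (Barnet-Lamb–Gee–Geraghty–Taylor 2014, §2.1), which implies it.
* The ordinary clause is the explicit matrix shape of the route, NOT Geraghty's "ordinary of
  weight `λ`" = the accepted `FramedGaloisRep.IsOrdinaryOfLabelledWeight(At)` /
  `IsOrdinaryRegularAt` of `OrdinaryRegular` (diagonal prescribed on an open subgroup of inertia
  through a local Artin datum, embedding-labelled weights): here the `ψ_i` are unramified on all
  of `I_{K_v}`, the weights `b_i` are parallel and no Artin datum enters.  Such a representation is an iterated extension
  of unramified twists of powers of `ε_ℓ`, hence semistable — crystalline generically, not always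
  (Tate curve `0 → ε_ℓ → V → 1 → 0`, `b = (1, 0)`), whence the names say "cyclotomic-ordinary",
  exactly what is required, rather than "crystalline".  Meaningful (and used) only at `v ∣ ℓ`.
* Uniform approximation `≤ (ℓ⁻¹)^M` for every `M`: a limit is a continuous class function and, by
  Taylor's theorem on pseudo-representations (the tool behind Harris–Lan–Taylor–Thorne's "Hecke
  algebras of Galois type", §6.1), the trace of a semisimple `Γ_K → GL_N(ℚ̄_ℓ)`; NOT asserted here.
* NOT here: any existence statement (the route's cruxes), pseudo-representations, unitary
  groups.  No non-vacuity `example` with `N > 0` is possible (no automorphic representation is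
  constructible in the tree, cf. `ReciprocityGLnProofs`); the `N = 0`, `T = 0` instance (`.of_exact`
  with the empty family) and the proved API are the sanity checks.

## Sources (format precedents — the object is posited by the route, "HLTT §6 read backwards")

* M. Harris, K.-W. Lan, R. Taylor, J. Thorne, *On the rigid cohomology of certain Shimura
  varieties*, Res. Math. Sci. 3:37 (2016), §6.1 (arXiv:1411.6717 pp. 89–91): a Hecke algebra
  `𝕋` is "of Galois type" if there is "a continuous pseudo-representation `T : G_F^S → 𝕋` such
  that `d_v^{(i)} T(Frob_v^i) = d_v^{(i)} T_v^{(i)}` for all `v|q ∉ S`"; Lemma 6.2, Cor. 6.3–6.4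
  (the ordinary Hecke algebras `𝕋^{ord,S}(W)` are of Galois type), Prop. 6.5; Cor. 6.26–6.27.
  [HarrisLanTaylorThorneRMS2016]
* R. Taylor, *Galois representations associated to Siegel modular forms of low weight*, Duke
  Math. J. 63 (1991), §1 (pseudo-representations; representations as `p`-adic limits of
  automorphic traces). [Taylor1991]
* G. Chenevier, *On the infinite fern of Galois representations of unitary type*, Ann. Sci. ÉNS
  44 (2011) (density of automorphic points). [Chenevier2011]
* T. Barnet-Lamb, T. Gee, D. Geraghty, R. Taylor, *Potential automorphy and change of weight*,
  Ann. of Math. 179 (2014), §2.1 (essentially conjugate self-dual pairs; ordinary). [BarnetlambEtAl2014]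
-/

noncomputable section

open scoped NumberField BigOperators
open NumberField IsDedekindDomain Field Literature.NumberTheory.GaloisRepresentations

namespace Literature.NumberTheory.Automorphic

/-! ## The ordinary clause at a place above `ℓ` -/

section Ordinary

variable {F : Type} [Field F] [ValuativeRel F] [TopologicalSpace F] [IsNonarchimedeanLocalField F]
  {ℓ : ℕ} [Fact ℓ.Prime] {d : ℕ}

/-- **Upper-triangular with unramified-twisted cyclotomic diagonal and strictly decreasing
exponents** (`F` a non-archimedean local field, intended `F = K_v`, `v ∣ ℓ`;
`ρ : Γ_F → GL_d(ℚ̄_ℓ)` in a FIXED frame): there are integers `b_1 > ⋯ > b_d` (`StrictAnti b`;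
pairwise distinct — "regular") and unramified characters `ψ_i : Γ_F → GL_1(ℚ̄_ℓ)` (accepted
`FramedRep.IsLocallyUnramified`: trivial on the inertia group `I_F`) such that for every `σ`
the matrix `ρ(σ)` is upper triangular (entries `(i₁, i₂)`, `i₂ < i₁`, vanish) with diagonal
entries `ψ_i(σ) · ε_ℓ(σ)^{b_i}`, `ε_ℓ` the `ℓ`-adic cyclotomic character of `F` (accepted
`GaloisRep.cyclotomicCharacter`, in `ℤ_ℓ^×`, read in `ℚ̄_ℓ` via `ℤ_ℓ → ℚ_ℓ → ℚ̄_ℓ`; `b_i ∈ ℤ`,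
a `zpow`).  Dot-notation extension of the accepted `FramedRep`, declared with its absolute
name; verbatim the matrix shape inlined in route SiegelEisensteinFern. [folklore] -/
def _root_.Literature.NumberTheory.GaloisRepresentations.FramedRep.IsCyclotomicOrdinaryTriangular
    (ρ : FramedRep (absoluteGaloisGroup F) (PadicAlgCl ℓ) d) : Prop :=
  ∃ (b : Fin d → ℤ) (ψ : Fin d → FramedRep (absoluteGaloisGroup F) (PadicAlgCl ℓ) 1),
    StrictAnti b ∧ (∀ i, (ψ i).IsLocallyUnramified) ∧
      ∀ σ, (∀ i₁ i₂ : Fin d, i₂ < i₁ → (ρ σ).val i₁ i₂ = 0) ∧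
        (∀ i, (ρ σ).val i i =
          (ψ i).trace σ * (algebraMap ℚ_[ℓ] (PadicAlgCl ℓ)
            ((GaloisRep.cyclotomicCharacter F ℓ σ : ℤ_[ℓ]ˣ) : ℤ_[ℓ])) ^ (b i))

/-- The same in the vocabulary of the accepted `OrdinaryRegular` (`FramedRep.IsUpperTriangular`,
`FramedRep.diagEntry`; so that the diagonal characters `IsUpperTriangular.diagChar` are
available): `ρ` is upper triangular and its diagonal entries are `ψ_i · ε_ℓ^{b_i}`. [folklore] -/
theorem _root_.Literature.NumberTheory.GaloisRepresentations.FramedRep.isCyclotomicOrdinaryTriangular_iff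
    (ρ : FramedRep (absoluteGaloisGroup F) (PadicAlgCl ℓ) d) :
    ρ.IsCyclotomicOrdinaryTriangular ↔ ρ.IsUpperTriangular ∧
      ∃ (b : Fin d → ℤ) (ψ : Fin d → FramedRep (absoluteGaloisGroup F) (PadicAlgCl ℓ) 1),
        StrictAnti b ∧ (∀ i, (ψ i).IsLocallyUnramified) ∧
          ∀ σ i, ρ.diagEntry i σ = (ψ i).trace σ * (algebraMap ℚ_[ℓ] (PadicAlgCl ℓ)
            ((GaloisRep.cyclotomicCharacter F ℓ σ : ℤ_[ℓ]ˣ) : ℤ_[ℓ])) ^ (b i) := by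
  constructor
  · rintro ⟨b, ψ, hb, hψ, h⟩
    exact ⟨fun σ i j hij ↦ (h σ).1 i j hij, b, ψ, hb, hψ, fun σ i ↦ (h σ).2 i⟩
  · rintro ⟨htri, b, ψ, hb, hψ, h⟩
    exact ⟨b, ψ, hb, hψ, fun σ ↦ ⟨fun i j hij ↦ htri σ i j hij, fun i ↦ h σ i⟩⟩

/-- **`ρ : Γ_F → GL_d(ℚ̄_ℓ)` is ordinary with unramified-twisted cyclotomic diagonal and strictly
decreasing exponents**: some change of frame `g ρ g⁻¹` (accepted `FramedRep.conj`) is upper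
triangular of that shape (`IsCyclotomicOrdinaryTriangular`).  Such a `ρ` is an iterated
extension of unramified twists of integral powers of `ε_ℓ` (parallel Hodge–Tate weights `b_i`),
hence semistable; it renders the phrase "crystalline-ordinary with distinct Hodge–Tate weights"
of route SiegelEisensteinFern by exactly what its items require, and differs from the accepted
`IsOrdinaryRegular` of `OrdinaryRegular` (Geraghty's "ordinary of weight `λ`"; module docstring).
[folklore] -/
def _root_.Literature.NumberTheory.GaloisRepresentations.FramedRep.IsCyclotomicOrdinary
    (ρ : FramedRep (absoluteGaloisGroup F) (PadicAlgCl ℓ) d) : Prop :=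
  ∃ g : GL (Fin d) (PadicAlgCl ℓ), (ρ.conj g).IsCyclotomicOrdinaryTriangular

/-- The ordinary condition does not depend on the frame: `P ρ P⁻¹` is ordinary iff `ρ` is
(conjugate by `g P`, resp. `g P⁻¹`). [folklore] -/
theorem _root_.Literature.NumberTheory.GaloisRepresentations.FramedRep.isCyclotomicOrdinary_conj_iff
    (P : GL (Fin d) (PadicAlgCl ℓ)) (ρ : FramedRep (absoluteGaloisGroup F) (PadicAlgCl ℓ) d) :
    (FramedRep.conj P ρ).IsCyclotomicOrdinary ↔ ρ.IsCyclotomicOrdinary := by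
  constructor
  · rintro ⟨g, hg⟩
    exact ⟨g * P, by rwa [← FramedRep.conj_conj]⟩
  · rintro ⟨g, hg⟩
    refine ⟨g * P⁻¹, ?_⟩
    rwa [FramedRep.conj_conj, inv_mul_cancel_right]

variable {K : Type} [Field K] [NumberField K]

/-- **`r : Γ_K → GL_d(ℚ̄_ℓ)` is ordinary at the finite place `v` (intended `v ∣ ℓ`) with
unramified-twisted cyclotomic diagonal and strictly decreasing exponents**: its restriction
`r|_{Γ_{K_v}}` (accepted `FramedGaloisRep.toLocal`) is `IsCyclotomicOrdinary`.  Unfolded —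
`∃ g b ψ, StrictAnti b ∧ (∀ i, ψ_i unramified) ∧ ∀ σ, g r|_{Γ_{K_v}}(σ) g⁻¹` upper triangular
with diagonal `ψ_i(σ) ε_ℓ(σ)^{b_i}` — this is verbatim the clause "crystalline-ordinary with
distinct Hodge–Tate weights at `v ∣ ℓ`" inlined in route SiegelEisensteinFern. [folklore] -/
def _root_.Literature.NumberTheory.GaloisRepresentations.FramedGaloisRep.IsCyclotomicOrdinaryAt
    (v : HeightOneSpectrum (𝓞 K)) (r : FramedGaloisRep K (PadicAlgCl ℓ) d) : Prop :=
  (r.toLocal v).IsCyclotomicOrdinary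

/-- The ordinary clause at `v` is invariant under a global change of frame `r ↦ P r P⁻¹`.
[folklore] -/
theorem _root_.Literature.NumberTheory.GaloisRepresentations.FramedGaloisRep.isCyclotomicOrdinaryAt_conj_iff
    (v : HeightOneSpectrum (𝓞 K)) (P : GL (Fin d) (PadicAlgCl ℓ))
    (r : FramedGaloisRep K (PadicAlgCl ℓ) d) :
    FramedGaloisRep.IsCyclotomicOrdinaryAt v (FramedRep.conj P r) ↔ r.IsCyclotomicOrdinaryAt v := by
  simp only [FramedGaloisRep.IsCyclotomicOrdinaryAt, FramedGaloisRep.toLocal_conj]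
  exact FramedRep.isCyclotomicOrdinary_conj_iff P (r.toLocal v)

end Ordinary

/-! ## The polarization involution -/

section Involution

variable {F K : Type*} [Field F] [Field K] [Algebra F K] [IsGalois F K] [CharZero K]

/-- **The route's binder `θ` is `θ_c`.**  For `K/F` Galois and `τ ∈ Γ_F`, a continuous
endomorphism `θ` of `Γ_K` with `res (θ σ) = τ · res σ · τ⁻¹` for all `σ` (`res = absGaloisRestrict
F K`, a closed embedding with normal image) is the accepted outer action `absGaloisOuterConj F K τ`
(route SiegelEisensteinFern binds its polarization involution exactly by this property, which
`absGaloisRestrict_absGaloisOuterConj` shows to be satisfiable). [folklore] -/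
theorem _root_.Literature.NumberTheory.GaloisRepresentations.eq_absGaloisOuterConj
    (τ : absoluteGaloisGroup F) (θ : absoluteGaloisGroup K →ₜ* absoluteGaloisGroup K)
    (h : ∀ σ, absGaloisRestrict F K (θ σ) = τ * absGaloisRestrict F K σ * τ⁻¹) :
    θ = absGaloisOuterConj F K τ :=
  ContinuousMonoidHom.ext fun σ ↦ absGaloisRestrict_injective F K <| by
    rw [h, absGaloisRestrict_absGaloisOuterConj]

end Involution

/-! ## Polarized class functions and the Siegel–Eisenstein trace -/

section Polarized

variable {G : Type*} [Group G] [TopologicalSpace G] {A : Type*} [CommRing A] [TopologicalSpace A]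
  {n : ℕ}

/-- **`t : G → A` is polarized in trace form** with respect to the continuous endomorphism `θ`
of the topological group `G` (intended: `G = Γ_K`, `K` CM, `θ = θ_c` the outer action of complex
conjugation): there is a continuous character `χ : G → GL_1(A)` with `t(θ σ) = tr χ(σ) · t(σ⁻¹)`
for all `σ`.  For `t = tr r`, `r` semisimple, this is `r ∘ θ ≅ r^∨ ⊗ χ` — conjugate self-dual up
to twist; the trace-level shadow of an essentially conjugate self-dual pair of
Barnet-Lamb–Gee–Geraghty–Taylor 2014, §2.1 (no sign condition, `χ` a character of `G` itself).
Verbatim the polarization clause of route SiegelEisensteinFern. [folklore] -/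
def IsTracePolarized (θ : G →ₜ* G) (t : G → A) : Prop :=
  ∃ χ : FramedRep G A 1, ∀ σ, t (θ σ) = χ.trace σ * t σ⁻¹

/-- Unfolding `IsTracePolarized`. [folklore] -/
theorem isTracePolarized_iff (θ : G →ₜ* G) (t : G → A) :
    IsTracePolarized θ t ↔ ∃ χ : FramedRep G A 1, ∀ σ, t (θ σ) = χ.trace σ * t σ⁻¹ :=
  Iff.rfl

/-- The zero function is polarized (by any character, e.g. the trivial one). [folklore] -/
theorem IsTracePolarized.zero (θ : G →ₜ* G) : IsTracePolarized θ (fun _ ↦ (0 : A)) :=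
  ⟨1, fun _ ↦ by simp⟩

/-- A scalar multiple of a polarized function is polarized, by the same character. [folklore] -/
theorem IsTracePolarized.const_mul {θ : G →ₜ* G} {t : G → A} (h : IsTracePolarized θ t) (a : A) :
    IsTracePolarized θ (fun σ ↦ a * t σ) := by
  obtain ⟨χ, hχ⟩ := h
  exact ⟨χ, fun σ ↦ by simp only [hχ σ]; ring⟩

/-- A sum of two functions polarized BY THE SAME CHARACTER is polarized. [folklore] -/
theorem IsTracePolarized.add_of_eq {θ : G →ₜ* G} {t t' : G → A} (χ : FramedRep G A 1)
    (h : ∀ σ, t (θ σ) = χ.trace σ * t σ⁻¹) (h' : ∀ σ, t' (θ σ) = χ.trace σ * t' σ⁻¹) :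
    IsTracePolarized θ (fun σ ↦ t σ + t' σ) :=
  ⟨χ, fun σ ↦ by simp only [h σ, h' σ]; ring⟩

/-- **The Siegel–Eisenstein trace** of `ρ : G → GL_n(A)` and a character `μ : G → GL_1(A)` with
respect to `θ : G → G`: `σ ↦ tr ρ(σ) + tr μ(σ) · tr ((ρ ∘ θ)^∨)(σ)`, the trace of the
`2n`-dimensional `R₀ = ρ ⊕ (ρ ∘ θ)^∨ ⊗ μ` (`(·)^∨` the inverse-transpose dual, accepted
`FramedRep.dual`).  For `G = Γ_K`, `K` CM, `θ = θ_c`: the shape `r(π) ⊕ r(π)^{c,∨} ε^{1-2n-2N}`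
of the representations `R_p(Π)` of Harris–Lan–Taylor–Thorne 2016, Prop. 6.5 / Cor. 6.26–6.27,
attached to Siegel–Eisenstein series on `U(n,n)`; the interface `T` of route SiegelEisensteinFern
(verbatim its `ρ.trace σ + μ.trace σ * (FramedRep.dual (ρ.comp θ)).trace σ`). [folklore] -/
def siegelEisensteinTrace (θ : G →ₜ* G) (ρ : FramedRep G A n) (μ : FramedRep G A 1) : G → A :=
  fun σ ↦ ρ.trace σ + μ.trace σ * (FramedRep.dual (ρ.comp θ)).trace σ

/-- Unfolding `siegelEisensteinTrace`. [folklore] -/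
@[simp] theorem siegelEisensteinTrace_apply (θ : G →ₜ* G) (ρ : FramedRep G A n)
    (μ : FramedRep G A 1) (σ : G) :
    siegelEisensteinTrace θ ρ μ σ = ρ.trace σ + μ.trace σ * (FramedRep.dual (ρ.comp θ)).trace σ :=
  rfl

/-- For `G = Γ_K` and `θ = θ_τ = absGaloisOuterConj F K τ` the Siegel–Eisenstein trace is
`tr ρ + tr μ · tr (ρ^τ)^∨` with the accepted conjugate representation `ρ^τ = ρ.outerConj τ`
(the wording of the definition request). [folklore] -/
theorem siegelEisensteinTrace_absGaloisOuterConj {F K : Type*} [Field F] [Field K] [Algebra F K]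
    [IsGalois F K] [CharZero K] (τ : absoluteGaloisGroup F) (ρ : FramedGaloisRep K A n)
    (μ : FramedGaloisRep K A 1) (σ : absoluteGaloisGroup K) :
    siegelEisensteinTrace (absGaloisOuterConj F K τ) ρ μ σ =
      ρ.trace σ + μ.trace σ * (ρ.outerConj τ).dual.trace σ :=
  rfl

end Polarized

/-! ## Ordinary polarized automorphic limits -/

section Limit

variable {K : Type} [Field K] [NumberField K] {ℓ : ℕ} [Fact ℓ.Prime]

/-- **`T : Γ_K → ℚ̄_ℓ` is an `ℓ`-adic limit of ordinary, polarized, cuspidal-automorphic Galois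
traces** of total dimension `N`, level `S` and polarization involution `θ` (`ι : ℚ̄_ℓ ≃ ℂ`): for
every `M : ℕ` there are `k`, dimensions `d : Fin k → ℕ` with `∑ d_j = N`, cuspidal automorphic
representations `Π_j` of `GL_{d_j}(𝔸_K)` (accepted `CuspidalAutomorphicRepData`; the compactness
facts `hd` typing them are part of the datum) and framed `r_j : Γ_K → GL_{d_j}(ℚ̄_ℓ)` with: each
`Π_j` regular algebraic; `r_j` compatible with `Π_j` at every `v ∤ ℓ` in the sense of lang.S27
(accepted `IsGaloisCompatibleAt`: unramified, arithmetic-Frobenius characteristic polynomial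
`arithFrobPolyOfSatake ι q_v d_j α` for every Satake parameter `α` of `Π_{j,v}`); `r_j` unramified
at every `v ∈ S`; `r_j` cyclotomic-ordinary with strictly decreasing exponents at every `v ∣ ℓ`
(`IsCyclotomicOrdinaryAt`); total trace `∑_j tr r_j` polarized in trace form w.r.t. `θ`
(`IsTracePolarized`); and `‖∑_j tr r_j(σ) - T(σ)‖ ≤ (ℓ⁻¹)^M` for all `σ`.  The interface "LIMIT"
of route SiegelEisensteinFern (Harris–Lan–Taylor–Thorne 2016 §6.1 "Hecke algebras of Galois
type", read backwards; GL-level); design choices in the module docstring. [folklore] -/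
def IsOrdinaryPolarizedAutomorphicLimit (ι : PadicAlgCl ℓ ≃+* ℂ)
    (θ : absoluteGaloisGroup K →ₜ* absoluteGaloisGroup K) (N : ℕ)
    (S : Set (HeightOneSpectrum (𝓞 K))) (T : absoluteGaloisGroup K → PadicAlgCl ℓ) : Prop :=
  ∀ M : ℕ, ∃ (k : ℕ) (d : Fin k → ℕ) (hd : ∀ j, isCompact_glFiniteIntegralLevel (d j) K)
      (P : ∀ j, CuspidalAutomorphicRepData (d j) K (hd j))
      (r : ∀ j, FramedGaloisRep K (PadicAlgCl ℓ) (d j)),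
    (∑ j, d j = N) ∧
    (∀ j, (P j).1.IsRegularAlgebraic ∧
      (∀ v : HeightOneSpectrum (𝓞 K), ((ℓ : ℕ) : 𝓞 K) ∉ v.asIdeal →
        IsGaloisCompatibleAt (P j).1 ι (r j) v) ∧
      (∀ v ∈ S, (r j).IsUnramifiedAt v) ∧
      (∀ v : HeightOneSpectrum (𝓞 K), ((ℓ : ℕ) : 𝓞 K) ∈ v.asIdeal →
        (r j).IsCyclotomicOrdinaryAt v)) ∧
    IsTracePolarized θ (fun σ ↦ ∑ j, (r j).trace σ) ∧
    ∀ σ, ‖(∑ j, (r j).trace σ) - T σ‖ ≤ ((ℓ : ℝ)⁻¹) ^ M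

variable {ι : PadicAlgCl ℓ ≃+* ℂ} {θ : absoluteGaloisGroup K →ₜ* absoluteGaloisGroup K} {N : ℕ}
  {S S' : Set (HeightOneSpectrum (𝓞 K))} {T T' : absoluteGaloisGroup K → PadicAlgCl ℓ}

/-- A limit of level `S` is a limit of any smaller level `S' ⊆ S`. [folklore] -/
theorem IsOrdinaryPolarizedAutomorphicLimit.anti (h : IsOrdinaryPolarizedAutomorphicLimit ι θ N S T)
    (hS : S' ⊆ S) : IsOrdinaryPolarizedAutomorphicLimit ι θ N S' T := fun M ↦ by
  obtain ⟨k, d, hd, P, r, hN, hj, hpol, happ⟩ := h M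
  exact ⟨k, d, hd, P, r, hN, fun j ↦ ⟨(hj j).1, (hj j).2.1, fun v hv ↦ (hj j).2.2.1 v (hS hv),
    (hj j).2.2.2⟩, hpol, happ⟩

/-- The predicate only depends on the values of `T`. [folklore] -/
theorem IsOrdinaryPolarizedAutomorphicLimit.congr (h : IsOrdinaryPolarizedAutomorphicLimit ι θ N S T)
    (hT : ∀ σ, T σ = T' σ) : IsOrdinaryPolarizedAutomorphicLimit ι θ N S T' :=
  (funext hT : T = T') ▸ h

/-- **Limits of limits are limits**: if for every `M` the function `T` is uniformly within
`(ℓ⁻¹)^M` of some limit `T'` (same `ι, θ, N, S`), then `T` is a limit (triangle inequality;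
`2 (ℓ⁻¹)^{M+1} ≤ (ℓ⁻¹)^M` as `ℓ ≥ 2`). [folklore] -/
theorem IsOrdinaryPolarizedAutomorphicLimit.of_approx
    (h : ∀ M : ℕ, ∃ T' : absoluteGaloisGroup K → PadicAlgCl ℓ,
      IsOrdinaryPolarizedAutomorphicLimit ι θ N S T' ∧ ∀ σ, ‖T' σ - T σ‖ ≤ ((ℓ : ℝ)⁻¹) ^ M) :
    IsOrdinaryPolarizedAutomorphicLimit ι θ N S T := fun M ↦ by
  obtain ⟨T', hT', hclose⟩ := h (M + 1)
  obtain ⟨k, d, hd, P, r, hN, hj, hpol, happ⟩ := hT' (M + 1)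
  refine ⟨k, d, hd, P, r, hN, hj, hpol, fun σ ↦ ?_⟩
  have hℓ : (2 : ℝ) ≤ ℓ := by exact_mod_cast (Fact.out : ℓ.Prime).two_le
  have hℓ0 : (0 : ℝ) < ℓ := by linarith
  have h2 : 2 * (ℓ : ℝ)⁻¹ ≤ 1 := by
    rw [mul_inv_le_iff₀ hℓ0, one_mul]
    exact hℓ
  calc ‖(∑ j, (r j).trace σ) - T σ‖
      ≤ ‖(∑ j, (r j).trace σ) - T' σ‖ + ‖T' σ - T σ‖ := norm_sub_le_norm_sub_add_norm_sub _ _ _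
    _ ≤ ((ℓ : ℝ)⁻¹) ^ (M + 1) + ((ℓ : ℝ)⁻¹) ^ (M + 1) := add_le_add (happ σ) (hclose σ)
    _ = (2 * (ℓ : ℝ)⁻¹) * ((ℓ : ℝ)⁻¹) ^ M := by ring
    _ ≤ 1 * ((ℓ : ℝ)⁻¹) ^ M := by gcongr
    _ = ((ℓ : ℝ)⁻¹) ^ M := one_mul _

/-- An **exact** datum is a limit: one finite family of the required kind with total trace `T`
serves for every `M`. [folklore] -/
theorem IsOrdinaryPolarizedAutomorphicLimit.of_exact {k : ℕ} (d : Fin k → ℕ)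
    (hd : ∀ j, isCompact_glFiniteIntegralLevel (d j) K)
    (P : ∀ j, CuspidalAutomorphicRepData (d j) K (hd j))
    (r : ∀ j, FramedGaloisRep K (PadicAlgCl ℓ) (d j)) (hN : ∑ j, d j = N)
    (hj : ∀ j, (P j).1.IsRegularAlgebraic ∧
      (∀ v : HeightOneSpectrum (𝓞 K), ((ℓ : ℕ) : 𝓞 K) ∉ v.asIdeal →
        IsGaloisCompatibleAt (P j).1 ι (r j) v) ∧
      (∀ v ∈ S, (r j).IsUnramifiedAt v) ∧
      (∀ v : HeightOneSpectrum (𝓞 K), ((ℓ : ℕ) : 𝓞 K) ∈ v.asIdeal →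
        (r j).IsCyclotomicOrdinaryAt v))
    (hpol : IsTracePolarized θ (fun σ ↦ ∑ j, (r j).trace σ)) (hT : ∀ σ, ∑ j, (r j).trace σ = T σ) :
    IsOrdinaryPolarizedAutomorphicLimit ι θ N S T := fun M ↦
  ⟨k, d, hd, P, r, hN, hj, hpol, fun σ ↦ by
    rw [hT σ, sub_self, norm_zero]
    exact pow_nonneg (inv_nonneg.2 (Nat.cast_nonneg ℓ)) M⟩

/-- **Unfolding to the primitive vocabulary of the route**: `IsGaloisCompatibleAt`,
`IsTracePolarized`, `IsCyclotomicOrdinaryAt` unfolded and the matching clause in the binder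
order `∀ v α, HasSatakeParamAt v α → ℓ ∉ v → …` used verbatim by the items of route
SiegelEisensteinFern (there `N = n + n`, `T = siegelEisensteinTrace θ ρ μ`,
`S = {v | ρ.IsUnramifiedAt v ∧ μ.IsUnramifiedAt v ∧ ℓ ∉ v}` with the level clause curried).
[folklore] -/
theorem isOrdinaryPolarizedAutomorphicLimit_iff (ι : PadicAlgCl ℓ ≃+* ℂ)
    (θ : absoluteGaloisGroup K →ₜ* absoluteGaloisGroup K) (N : ℕ)
    (S : Set (HeightOneSpectrum (𝓞 K))) (T : absoluteGaloisGroup K → PadicAlgCl ℓ) :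
    IsOrdinaryPolarizedAutomorphicLimit ι θ N S T ↔
      ∀ M : ℕ, ∃ (k : ℕ) (d : Fin k → ℕ) (hd : ∀ j, isCompact_glFiniteIntegralLevel (d j) K)
          (P : ∀ j, CuspidalAutomorphicRepData (d j) K (hd j))
          (r : ∀ j, FramedGaloisRep K (PadicAlgCl ℓ) (d j)),
        (∑ j, d j = N) ∧
        (∀ j, (P j).1.IsRegularAlgebraic ∧
          (∀ (v : HeightOneSpectrum (𝓞 K)) (α : Multiset ℂ), (P j).1.HasSatakeParamAt v α →
            ((ℓ : ℕ) : 𝓞 K) ∉ v.asIdeal →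
              (r j).IsUnramifiedAt v ∧
                (r j).HasFrobCharpolyAt v (arithFrobPolyOfSatake ι v.residueCard (d j) α)) ∧
          (∀ v : HeightOneSpectrum (𝓞 K), v ∈ S → (r j).IsUnramifiedAt v) ∧
          (∀ v : HeightOneSpectrum (𝓞 K), ((ℓ : ℕ) : 𝓞 K) ∈ v.asIdeal →
            ∃ (g : GL (Fin (d j)) (PadicAlgCl ℓ)) (b : Fin (d j) → ℤ)
              (ψ : Fin (d j) → FramedRep (absoluteGaloisGroup (v.adicCompletion K)) (PadicAlgCl ℓ) 1),
              StrictAnti b ∧ (∀ i, (ψ i).IsLocallyUnramified) ∧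
                ∀ σ, (∀ i₁ i₂ : Fin (d j), i₂ < i₁ → (((r j).toLocal v).conj g σ).val i₁ i₂ = 0) ∧
                  (∀ i, (((r j).toLocal v).conj g σ).val i i =
                    (ψ i).trace σ * (algebraMap ℚ_[ℓ] (PadicAlgCl ℓ)
                      ((GaloisRep.cyclotomicCharacter (v.adicCompletion K) ℓ σ : ℤ_[ℓ]ˣ) :
                        ℤ_[ℓ])) ^ (b i)))) ∧
        (∃ χ : FramedGaloisRep K (PadicAlgCl ℓ) 1, ∀ σ,
          (∑ j, (r j).trace (θ σ)) = χ.trace σ * ∑ j, (r j).trace σ⁻¹) ∧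
        ∀ σ, ‖(∑ j, (r j).trace σ) - T σ‖ ≤ ((ℓ : ℝ)⁻¹) ^ M := by
  refine forall_congr' fun M ↦ exists_congr fun k ↦ exists_congr fun d ↦ exists_congr fun hd ↦
    exists_congr fun P ↦ exists_congr fun r ↦ and_congr_right fun _ ↦ and_congr ?_ Iff.rfl
  refine forall_congr' fun j ↦ and_congr_right fun _ ↦ and_congr ?_ Iff.rfl
  exact ⟨fun h v α hα hv ↦ h v hv α hα, fun h v hv α hα ↦ h v α hα hv⟩

end Limit

end Literature.NumberTheory.Automorphic
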